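import Mathlib
import Literature.RingTheory.LocalCohomology.GrothendieckConnectedness
import Literature.AlgebraicGeometry.Resolution.CoefficientRingsProofs
import Literature.AlgebraicGeometry.Resolution.FormalFibres
import Summits.Langlands.Langlands.Theorems.SkinnerWilesDefectOneReducibleOrdinaryProModularDomainComponentDim
import Summits.Langlands.Langlands.Theorems.SkinnerWilesDefectOneReducibleOrdinaryProModularConnectednessComponents
import Summits.Langlands.Langlands.Theorems.SkinnerWilesDefectOneReducibleOrdinaryProModularConnectednessIntegralTransfer
import Summits.Langlands.Langlands.Theorems.SkinnerWilesDefectOneReducibleOrdinaryProModularReflexiveHull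
import Summits.Langlands.Langlands.Theorems.SkinnerWilesDefectOneReducibleOrdinaryProModularCohenMacaulayConnectedness
import Summits.Langlands.Langlands.Theorems.SkinnerWilesDefectOneReducibleOrdinaryProModularReflexiveHullLocal
import Literature.AlgebraicGeometry.Resolution.RegularLocalRingsQuotient
import Literature.AlgebraicGeometry.Resolution.RegularLocalRingsProofs
import Summits.Langlands.Langlands.Theorems.SkinnerWilesDefectOneReducibleOrdinaryProModularHypersurfaceHull

/-!
# Grothendieck's connectedness theorem SGA 2 XIII 2.1 — the proof (assembly and induction)

Route `SkinnerWilesDefectOne`, crux `ReducibleOrdinaryProModular` (stmt-Langlands-12919), line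
`fine-selmer-codimension-two`, stub (R) `stub_raynaudConnectedness`.  This file PROVES the named literature fact
`Literature.RingTheory.LocalCohomology.GrothendieckConnectedness` (SGA 2 XIII Théorème 2.1: for a complete
Noetherian local ring `A` whose punctured spectrum has components of dimension `≥ k + 1` and is connected in
dimension `≥ k`, and `f₁, …, f_m ∈ 𝔪`, `m ≤ k`, the subscheme `V(f₁, …, f_m)` has the same properties with
`k − m`), to which stub (R) was reduced by `…GrothendieckConnectednessReduction.lean`.

The proof (lead c3) follows Grothendieck's own sketch (SGA 2 XIII §2, p. 95 of arXiv:math/0511279: "on est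
ramené au cas où X est intègre, et même … normal; … récurrence sur k") with two substitutions that make it
elementary — no local cohomology beyond the tree's Čech complexes, no Hartshorne–Lichtenbaum vanishing, no
local duality, no formal functions, no normalisation, no Bertini:
* the normalisation is replaced by the REFLEXIVE HULL `D'` of the domain `A/P` over its Cohen subring `S`
  (tree `Matsumura1987_29_4_iii_holds`; `…ReflexiveHull.lean`, `…ReflexiveHullLocal.lean`): a finite extension
  domain which is a second syzygy over the complete regular local ring `S`;
* the local Lefschetz step is replaced by the ALGEBRAIC LOCAL LEFSCHETZ THEOREM (`…AlgebraicLefschetz.lean`: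
  punctured `V(f)` is connected in a Noetherian local ring of depth `≥ 2` whose Čech `H²` is `f`-power
  torsion), applied to `D'` and to its localisations at primes of coheight `≤ d − 3` — where depth and torsion
  come from the syzygy presentation over the regular rings `S`, `S_𝔮` (Serre) — giving that every hypersurface
  of `D'` is connected in codimension one (`…HypersurfaceHull.lean`, step (M1)).
Then: strong induction on `k` (this file): (G1) `…ConnectednessComponents.lean` reduces to the components
`A/P`; (M1) + the induction hypothesis at `k − 1` applied to `D'/(g₁)` give the statement for `D'`
(`gc_hull`); (G2) `…ConnectednessIntegralTransfer.lean` descends along `A/P ⊆ D'`; the dimension bookkeeping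
is (A1) `…DomainComponentDim.lean`.

* `Theorems.grothendieckConnectedness_of_hypersurfaceHull` — the induction from (M1) as a hypothesis;
* `Theorems.GrothendieckConnectedness_holds` — **SGA 2 XIII 2.1, unconditionally** (discharges the named fact);
  the deduction of stub (R) is the three-line file `…RaynaudConnectedness.lean`.

References: A. Grothendieck, SGA 2, Exp. XIII Thm. 2.1 and §2 [Grothendieck1968SGA2]; R. Hartshorne, Amer. J.
Math. 84 (1962) [Hartshorne1962]; H. Matsumura, *Commutative Ring Theory*, Thm. 29.4 [Matsumura1987];
M. Brodmann, R. Sharp, *Local cohomology*, 19.2 [BrodmannSharp1998] (the classical HLVT route, NOT used).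
-/
set_option linter.dupNamespace false -- project-wide option (lakefile weak.linter.dupNamespace); `Summit.Langlands.Langlands` is the mandated namespace
set_option autoImplicit false

noncomputable section

namespace Summit.Langlands.Langlands.Theorems

open IsLocalRing
open Summit.Langlands.Langlands.Cruxes.ReducibleOrdinaryProModular.FineSelmerCodimensionTwo
  (stub_raynaudConnectedness_auxDomainComponentDim stub_raynaudConnectedness_auxComponents
   stub_raynaudConnectedness_auxHull stub_raynaudConnectedness_auxHullCompleteLocal
   stub_raynaudConnectedness_auxHypersurfaceHull)

universe u

/-! ## 1. Elementary facts about the crossing property -/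

section Crossing

variable {R : Type u} [CommRing R]

/-- Monotonicity of the crossing property in the bound. [folklore] -/
theorem crossing_mono {n n' : WithBot ℕ∞} (hn : n' ≤ n)
    (h : ∀ S : Set (PrimeSpectrum R), (∃ C ∈ S, C.asIdeal ∈ minimalPrimes R) →
      (∃ C ∉ S, C.asIdeal ∈ minimalPrimes R) →
        ∃ C₁ ∈ S, ∃ C₂ ∉ S, C₁.asIdeal ∈ minimalPrimes R ∧ C₂.asIdeal ∈ minimalPrimes R ∧
          n ≤ ringKrullDim (R ⧸ (C₁.asIdeal ⊔ C₂.asIdeal)))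
    (S : Set (PrimeSpectrum R)) (h₁ : ∃ C ∈ S, C.asIdeal ∈ minimalPrimes R)
    (h₂ : ∃ C ∉ S, C.asIdeal ∈ minimalPrimes R) :
    ∃ C₁ ∈ S, ∃ C₂ ∉ S, C₁.asIdeal ∈ minimalPrimes R ∧ C₂.asIdeal ∈ minimalPrimes R ∧
      n' ≤ ringKrullDim (R ⧸ (C₁.asIdeal ⊔ C₂.asIdeal)) := by
  obtain ⟨C₁, hC₁S, C₂, hC₂S, hC₁, hC₂, hle⟩ := h S h₁ h₂
  exact ⟨C₁, hC₁S, C₂, hC₂S, hC₁, hC₂, hn.trans hle⟩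

/-- A domain has the crossing property in every dimension (vacuously: one minimal prime). [folklore] -/
theorem crossing_of_isDomain [IsDomain R] (n : WithBot ℕ∞)
    (S : Set (PrimeSpectrum R)) (h₁ : ∃ C ∈ S, C.asIdeal ∈ minimalPrimes R)
    (h₂ : ∃ C ∉ S, C.asIdeal ∈ minimalPrimes R) :
    ∃ C₁ ∈ S, ∃ C₂ ∉ S, C₁.asIdeal ∈ minimalPrimes R ∧ C₂.asIdeal ∈ minimalPrimes R ∧
      n ≤ ringKrullDim (R ⧸ (C₁.asIdeal ⊔ C₂.asIdeal)) := by
  exfalso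
  obtain ⟨C₁, hC₁S, hC₁⟩ := h₁
  obtain ⟨C₂, hC₂S, hC₂⟩ := h₂
  have h1 : C₁.asIdeal = ⊥ := by
    have := hC₁; rw [IsDomain.minimalPrimes_eq_singleton_bot] at this; exact this
  have h2 : C₂.asIdeal = ⊥ := by
    have := hC₂; rw [IsDomain.minimalPrimes_eq_singleton_bot] at this; exact this
  exact hC₂S ((PrimeSpectrum.ext (h2.trans h1.symm)) ▸ hC₁S)

end Crossing


/-! ## 2. Small ideal-theoretic lemmas -/

section Lemmas

variable {D : Type u} [CommRing D]

/-- Removing zeros from a list does not change the ideal it generates. [folklore] -/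
theorem ofList_filter_ne_zero [DecidableEq D] (gs : List D) :
    Ideal.ofList (gs.filter (· ≠ 0)) = Ideal.ofList gs := by
  induction gs with
  | nil => simp
  | cons g rest ih =>
    by_cases hg : g = 0
    · subst hg
      rw [List.filter_cons_of_neg (by simp), ih, Ideal.ofList_cons, Ideal.span_singleton_eq_bot.mpr rfl,
        bot_sup_eq]
    · rw [List.filter_cons_of_pos (by simpa using hg), Ideal.ofList_cons, Ideal.ofList_cons, ih]

end Lemmas

/-! ## 3. `T''(k)` for the hull: lists of hypersurfaces, from (M1) and the induction hypothesis -/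

section Hull

variable {k : ℕ}
variable {D : Type} [CommRing D] [IsDomain D] [IsNoetherianRing D] [IsLocalRing D]
  [IsAdicComplete (IsLocalRing.maximalIdeal D) D] {d : ℕ}

/-- **`T''(k)` for lists without zeros.**  In a complete local Noetherian domain `D` of dimension
`d ≥ k + 2` all of whose non-zero hypersurfaces `V(f)` are connected in dimension `d - 2` (hypothesis
(M1)), every `V(g₁, …, g_m)` with `gᵢ ≠ 0`, `m ≤ k`, is connected in dimension `k - m + 1` — given
Grothendieck's theorem at the levels `< k` (applied to the complete local ring `D/(g₁)`).
[cite: Grothendieck1968SGA2, Exp. XIII §2] -/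
theorem gc_hull_nonzero (hk : 1 ≤ k)
    (IH : ∀ k' < k, 1 ≤ k' → ∀ (A : Type) [CommRing A] [IsNoetherianRing A] [IsLocalRing A] [IsAdicComplete (IsLocalRing.maximalIdeal A) A], (∀ P : Ideal A, P ∈ minimalPrimes A → ((k' + 2 : ℕ) : WithBot ℕ∞) ≤ ringKrullDim (A ⧸ P)) → (∀ S : Set (PrimeSpectrum A), (∃ C ∈ S, C.asIdeal ∈ minimalPrimes A) → (∃ C ∉ S, C.asIdeal ∈ minimalPrimes A) → ∃ C₁ ∈ S, ∃ C₂ ∉ S, C₁.asIdeal ∈ minimalPrimes A ∧ C₂.asIdeal ∈ minimalPrimes A ∧ ((k' + 1 : ℕ) : WithBot ℕ∞) ≤ ringKrullDim (A ⧸ (C₁.asIdeal ⊔ C₂.asIdeal))) → ∀ fs : List A, (∀ f ∈ fs, f ∈ IsLocalRing.maximalIdeal A) → fs.length ≤ k' → (∀ Q : Ideal (A ⧸ Ideal.ofList fs), Q ∈ minimalPrimes (A ⧸ Ideal.ofList fs) → ((k' - fs.length + 2 : ℕ) : WithBot ℕ∞) ≤ ringKrullDim ((A ⧸ Ideal.ofList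 fs) ⧸ Q)) ∧ (∀ S : Set (PrimeSpectrum (A ⧸ Ideal.ofList fs)), (∃ C ∈ S, C.asIdeal ∈ minimalPrimes (A ⧸ Ideal.ofList fs)) → (∃ C ∉ S, C.asIdeal ∈ minimalPrimes (A ⧸ Ideal.ofList fs)) → ∃ C₁ ∈ S, ∃ C₂ ∉ S, C₁.asIdeal ∈ minimalPrimes (A ⧸ Ideal.ofList fs) ∧ C₂.asIdeal ∈ minimalPrimes (A ⧸ Ideal.ofList fs) ∧ ((k' - fs.length + 1 : ℕ) : WithBot ℕ∞) ≤ ringKrullDim ((A ⧸ Ideal.ofList fs) ⧸ (C₁.asIdeal ⊔ C₂.asIdeal))))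
    (hd : (d : WithBot ℕ∞) = ringKrullDim D)
    (hkd : k + 2 ≤ d)
    (hM1 : ∀ f : D, f ≠ 0 → f ∈ maximalIdeal D →
      ∀ T : Set (PrimeSpectrum (D ⧸ Ideal.span {f})),
        (∃ C ∈ T, C.asIdeal ∈ minimalPrimes (D ⧸ Ideal.span {f})) →
        (∃ C ∉ T, C.asIdeal ∈ minimalPrimes (D ⧸ Ideal.span {f})) →
          ∃ C₁ ∈ T, ∃ C₂ ∉ T, C₁.asIdeal ∈ minimalPrimes (D ⧸ Ideal.span {f}) ∧
            C₂.asIdeal ∈ minimalPrimes (D ⧸ Ideal.span {f}) ∧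
            ((d - 2 : ℕ) : WithBot ℕ∞) ≤ ringKrullDim ((D ⧸ Ideal.span {f}) ⧸ (C₁.asIdeal ⊔ C₂.asIdeal)))
    (gs : List D) (hgs : ∀ g ∈ gs, g ∈ maximalIdeal D) (hz : ∀ g ∈ gs, g ≠ 0) (hlen : gs.length ≤ k)
    (S : Set (PrimeSpectrum (D ⧸ Ideal.ofList gs)))
    (h₁ : ∃ C ∈ S, C.asIdeal ∈ minimalPrimes (D ⧸ Ideal.ofList gs))
    (h₂ : ∃ C ∉ S, C.asIdeal ∈ minimalPrimes (D ⧸ Ideal.ofList gs)) :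
    ∃ C₁ ∈ S, ∃ C₂ ∉ S, C₁.asIdeal ∈ minimalPrimes (D ⧸ Ideal.ofList gs) ∧
      C₂.asIdeal ∈ minimalPrimes (D ⧸ Ideal.ofList gs) ∧
      ((k - gs.length + 1 : ℕ) : WithBot ℕ∞) ≤ ringKrullDim ((D ⧸ Ideal.ofList gs) ⧸ (C₁.asIdeal ⊔ C₂.asIdeal)) := by
  classical
  cases gs with
  | nil =>
    -- `D ⧸ ⊥` is a domain: one minimal prime, a colouring cannot use both colours
    haveI : IsDomain (D ⧸ Ideal.ofList ([] : List D)) := by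
      rw [Ideal.ofList_nil]; exact (Ideal.Quotient.isDomain_iff_prime _).mpr Ideal.isPrime_bot
    exact crossing_of_isDomain _ S h₁ h₂
  | cons g rest =>
    have hg0 : g ≠ 0 := hz g (by simp)
    have hgm : g ∈ maximalIdeal D := hgs g (by simp)
    have hrest : ∀ r ∈ rest, r ∈ maximalIdeal D := fun r hr => hgs r (by simp [hr])
    have hl : rest.length + 1 ≤ k := by simpa using hlen
    -- the hypersurface ring `B = D ⧸ (g)` (with the ideal written `ofList [g]`)
    have hIle : Ideal.ofList [g] ≤ maximalIdeal D := by
      rw [Ideal.ofList_singleton, Ideal.span_singleton_le_iff_mem]; exact hgm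
    haveI : Nontrivial (D ⧸ Ideal.ofList [g]) := Ideal.Quotient.nontrivial_iff.mpr
      (ne_top_of_le_ne_top (Ideal.IsMaximal.ne_top inferInstance) hIle)
    haveI : IsLocalRing (D ⧸ Ideal.ofList [g]) :=
      IsLocalRing.of_surjective' (Ideal.Quotient.mk _) Ideal.Quotient.mk_surjective
    haveI : IsAdicComplete (maximalIdeal (D ⧸ Ideal.ofList [g])) (D ⧸ Ideal.ofList [g]) :=
      Literature.AlgebraicGeometry.Resolution.isAdicComplete_quotient _
    -- (a_{k-1}) for `B`: minimal primes have dimension `≥ d - 1 ≥ (k - 1) + 2` (A1 with `e = d - 1`)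
    have haB : ∀ P : Ideal (D ⧸ Ideal.ofList [g]), P ∈ minimalPrimes (D ⧸ Ideal.ofList [g]) →
        ((k - 1 + 2 : ℕ) : WithBot ℕ∞) ≤ ringKrullDim ((D ⧸ Ideal.ofList [g]) ⧸ P) := by
      intro P hP
      have hA1 := stub_raynaudConnectedness_auxDomainComponentDim D [g] (d - 1)
        (fun f hf => by simp only [List.mem_singleton] at hf; subst hf; exact hgm)
        (by rw [← hd]; exact_mod_cast (show d - 1 + [g].length ≤ d by simp; omega)) P hP
      exact le_trans (by exact_mod_cast (show k - 1 + 2 ≤ d - 1 by omega)) hA1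
    -- (b_{k-1}) for `B`: `Cross(B, k) ⟸ Cross(B, d - 2)` = (M1), transported to `ofList [g]`
    have hbB : ∀ T : Set (PrimeSpectrum (D ⧸ Ideal.ofList [g])),
        (∃ C ∈ T, C.asIdeal ∈ minimalPrimes (D ⧸ Ideal.ofList [g])) →
        (∃ C ∉ T, C.asIdeal ∈ minimalPrimes (D ⧸ Ideal.ofList [g])) →
          ∃ C₁ ∈ T, ∃ C₂ ∉ T, C₁.asIdeal ∈ minimalPrimes (D ⧸ Ideal.ofList [g]) ∧
            C₂.asIdeal ∈ minimalPrimes (D ⧸ Ideal.ofList [g]) ∧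
            ((k - 1 + 1 : ℕ) : WithBot ℕ∞) ≤
              ringKrullDim ((D ⧸ Ideal.ofList [g]) ⧸ (C₁.asIdeal ⊔ C₂.asIdeal)) :=
      crossing_mono (by exact_mod_cast (show k - 1 + 1 ≤ d - 2 by omega))
        (crossing_of_ringEquiv (Ideal.quotEquivOfEq (Ideal.ofList_singleton g)) _ (hM1 g hg0 hgm))
    -- the final isomorphism `(D/(g)) / (rest̄) ≃ D / (g, rest)`
    set π := Ideal.Quotient.mk (Ideal.ofList [g]) with hπ
    have hmap : Ideal.ofList (rest.map π) = (Ideal.ofList rest).map π := (Ideal.map_ofList π rest).symm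
    have e : ((D ⧸ Ideal.ofList [g]) ⧸ Ideal.ofList (rest.map π)) ≃+* D ⧸ Ideal.ofList (g :: rest) :=
      (Ideal.quotEquivOfEq hmap).trans
        ((DoubleQuot.quotQuotEquivQuotSup (Ideal.ofList [g]) (Ideal.ofList rest)).trans
          (Ideal.quotEquivOfEq (by rw [← Ideal.ofList_append]; rfl)))
    have hrestπ : ∀ r ∈ rest.map π, r ∈ maximalIdeal (D ⧸ Ideal.ofList [g]) := by
      intro r hr
      obtain ⟨r₀, hr₀, rfl⟩ := List.mem_map.mp hr
      rw [← IsLocalRing.map_maximalIdeal_of_surjective π Ideal.Quotient.mk_surjective]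
      exact Ideal.mem_map_of_mem _ (hrest r₀ hr₀)
    -- case `k = 1`: then `rest = []` and (M1) suffices
    by_cases hk1 : k = 1
    · subst hk1
      have hrest0 : rest = [] := by
        rcases rest with _ | ⟨r, rest'⟩
        · rfl
        · simp at hl
      subst hrest0
      have : ((1 - [g].length + 1 : ℕ) : WithBot ℕ∞) ≤ ((1 - 1 + 1 : ℕ) : WithBot ℕ∞) := by simp
      exact crossing_mono this hbB S h₁ h₂
    -- case `k ≥ 2`: apply the induction hypothesis at level `k - 1` to `B` and `rest̄`
    have hk2 : 1 ≤ k - 1 := by omega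
    have hIH := (IH (k - 1) (by omega) hk2 (D ⧸ Ideal.ofList [g]) haB hbB (rest.map π) hrestπ
      (by rw [List.length_map]; omega)).2
    have hbound : ((k - (g :: rest).length + 1 : ℕ) : WithBot ℕ∞) ≤
        ((k - 1 - (rest.map π).length + 1 : ℕ) : WithBot ℕ∞) := by
      rw [List.length_map, List.length_cons]
      exact_mod_cast (show k - (rest.length + 1) + 1 ≤ k - 1 - rest.length + 1 by omega)
    exact crossing_mono hbound (crossing_of_ringEquiv e.symm _ hIH) S h₁ h₂

/-- **`T''(k)` for arbitrary lists** (zeros removed first). [cite: Grothendieck1968SGA2, Exp. XIII §2] -/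
theorem gc_hull (hk : 1 ≤ k)
    (IH : ∀ k' < k, 1 ≤ k' → ∀ (A : Type) [CommRing A] [IsNoetherianRing A] [IsLocalRing A] [IsAdicComplete (IsLocalRing.maximalIdeal A) A], (∀ P : Ideal A, P ∈ minimalPrimes A → ((k' + 2 : ℕ) : WithBot ℕ∞) ≤ ringKrullDim (A ⧸ P)) → (∀ S : Set (PrimeSpectrum A), (∃ C ∈ S, C.asIdeal ∈ minimalPrimes A) → (∃ C ∉ S, C.asIdeal ∈ minimalPrimes A) → ∃ C₁ ∈ S, ∃ C₂ ∉ S, C₁.asIdeal ∈ minimalPrimes A ∧ C₂.asIdeal ∈ minimalPrimes A ∧ ((k' + 1 : ℕ) : WithBot ℕ∞) ≤ ringKrullDim (A ⧸ (C₁.asIdeal ⊔ C₂.asIdeal))) → ∀ fs : List A, (∀ f ∈ fs, f ∈ IsLocalRing.maximalIdeal A) → fs.length ≤ k' → (∀ Q : Ideal (A ⧸ Ideal.ofList fs), Q ∈ minimalPrimes (A ⧸ Ideal.ofList fs) → ((k' - fs.length + 2 : ℕ) : WithBot ℕ∞) ≤ ringKrullDim ((A ⧸ Ideal.ofList fs)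 ⧸ Q)) ∧ (∀ S : Set (PrimeSpectrum (A ⧸ Ideal.ofList fs)), (∃ C ∈ S, C.asIdeal ∈ minimalPrimes (A ⧸ Ideal.ofList fs)) → (∃ C ∉ S, C.asIdeal ∈ minimalPrimes (A ⧸ Ideal.ofList fs)) → ∃ C₁ ∈ S, ∃ C₂ ∉ S, C₁.asIdeal ∈ minimalPrimes (A ⧸ Ideal.ofList fs) ∧ C₂.asIdeal ∈ minimalPrimes (A ⧸ Ideal.ofList fs) ∧ ((k' - fs.length + 1 : ℕ) : WithBot ℕ∞) ≤ ringKrullDim ((A ⧸ Ideal.ofList fs) ⧸ (C₁.asIdeal ⊔ C₂.asIdeal))))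
    (hd : (d : WithBot ℕ∞) = ringKrullDim D)
    (hkd : k + 2 ≤ d)
    (hM1 : ∀ f : D, f ≠ 0 → f ∈ maximalIdeal D →
      ∀ T : Set (PrimeSpectrum (D ⧸ Ideal.span {f})),
        (∃ C ∈ T, C.asIdeal ∈ minimalPrimes (D ⧸ Ideal.span {f})) →
        (∃ C ∉ T, C.asIdeal ∈ minimalPrimes (D ⧸ Ideal.span {f})) →
          ∃ C₁ ∈ T, ∃ C₂ ∉ T, C₁.asIdeal ∈ minimalPrimes (D ⧸ Ideal.span {f}) ∧
            C₂.asIdeal ∈ minimalPrimes (D ⧸ Ideal.span {f}) ∧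
            ((d - 2 : ℕ) : WithBot ℕ∞) ≤ ringKrullDim ((D ⧸ Ideal.span {f}) ⧸ (C₁.asIdeal ⊔ C₂.asIdeal)))
    (gs : List D) (hgs : ∀ g ∈ gs, g ∈ maximalIdeal D) (hlen : gs.length ≤ k)
    (S : Set (PrimeSpectrum (D ⧸ Ideal.ofList gs)))
    (h₁ : ∃ C ∈ S, C.asIdeal ∈ minimalPrimes (D ⧸ Ideal.ofList gs))
    (h₂ : ∃ C ∉ S, C.asIdeal ∈ minimalPrimes (D ⧸ Ideal.ofList gs)) :
    ∃ C₁ ∈ S, ∃ C₂ ∉ S, C₁.asIdeal ∈ minimalPrimes (D ⧸ Ideal.ofList gs) ∧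
      C₂.asIdeal ∈ minimalPrimes (D ⧸ Ideal.ofList gs) ∧
      ((k - gs.length + 1 : ℕ) : WithBot ℕ∞) ≤ ringKrullDim ((D ⧸ Ideal.ofList gs) ⧸ (C₁.asIdeal ⊔ C₂.asIdeal)) := by
  classical
  set gs₀ := gs.filter (· ≠ 0) with hgs₀
  have hI : Ideal.ofList gs₀ = Ideal.ofList gs := ofList_filter_ne_zero gs
  have hlen₀ : gs₀.length ≤ gs.length := List.length_filter_le _ _
  have hgs₀m : ∀ g ∈ gs₀, g ∈ maximalIdeal D := fun g hg => hgs g (List.mem_of_mem_filter hg)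
  have hgs₀z : ∀ g ∈ gs₀, g ≠ 0 := fun g hg => by simpa using (List.mem_filter.mp hg).2
  have key := gc_hull_nonzero hk IH hd hkd hM1 gs₀ hgs₀m hgs₀z (hlen₀.trans hlen)
  have hmono : ((k - gs.length + 1 : ℕ) : WithBot ℕ∞) ≤ ((k - gs₀.length + 1 : ℕ) : WithBot ℕ∞) := by
    exact_mod_cast (show k - gs.length + 1 ≤ k - gs₀.length + 1 by omega)
  exact crossing_mono hmono (crossing_of_ringEquiv (Ideal.quotEquivOfEq hI.symm) _ key) S h₁ h₂

end Hull



/-! ## 3b. Cohen's structure theorem, packaged with an abstract coefficient ring -/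

section Cohen

set_option linter.overlappingInstances false in
/-- **Cohen (Matsumura 29.4 (iii)), packaged**: a complete Noetherian local domain is a finite injective
algebra over SOME complete regular local ring (an abstract type, so that only one algebra structure is in
play downstream). [cite: Matsumura1987, Thm. 29.4 (iii)] -/
theorem exists_regular_complete_finite_injective (D : Type) [CommRing D] [IsDomain D] [IsLocalRing D]
    [IsNoetherianRing D] [IsAdicComplete (maximalIdeal D) D] :
    ∃ (S : Type) (_ : CommRing S) (_ : IsRegularLocalRing S) (_ : Algebra S D),
      IsAdicComplete (maximalIdeal S) S ∧ Module.Finite S D ∧ Function.Injective (algebraMap S D) := by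
  obtain ⟨S', hreg, hSc, hfin⟩ :=
    Literature.AlgebraicGeometry.Resolution.Matsumura1987_29_4_iii_holds D
  exact ⟨S', inferInstance, hreg, inferInstance, hSc, hfin, Subtype.val_injective⟩

end Cohen

/-! ## 4. The induction: Grothendieck's connectedness theorem from (M1) -/

section Main

/-- **Grothendieck's connectedness theorem SGA 2 XIII 2.1 from the hypersurface statement (M1) for
reflexive hulls.**  Strong induction on `k`: (G1) reduces to the irreducible components `A/P`; the
Cohen structure theorem (tree `Matsumura1987_29_4_iii_holds`) and the reflexive hull (H1a, H0) give a
finite extension domain `A/P ⊆ D'` which is a second syzygy over a complete regular local ring; (M1) and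
the induction hypothesis give `T''(k)` for `D'` (`gc_hull`); (G2) descends to `A/P`.
[cite: Grothendieck1968SGA2, Exp. XIII Thm. 2.1] -/
theorem grothendieckConnectedness_of_hypersurfaceHull
    (hM1 : ∀ (S : Type) [CommRing S] [IsRegularLocalRing S] (D : Type) [CommRing D] [IsDomain D] [IsNoetherianRing D] [IsLocalRing D] [Algebra S D] [Module.Finite S D], Function.Injective (algebraMap S D) → (IsLocalRing.maximalIdeal S).map (algebraMap S D) ≤ IsLocalRing.maximalIdeal D → IsLocalRing.maximalIdeal D ≤ ((IsLocalRing.maximalIdeal S).map (algebraMap S D)).radical → ∀ (a b : ℕ) (Φ : D →ₗ[S] (Fin a → S)) (Ψ : (Fin a → S) →ₗ[S] (Fin b → S)), Function.Injective Φ → LinearMap.range Φ = LinearMap.ker Ψ → ∀ (d : ℕ), (d : WithBot ℕ∞) = ringKrullDim S → 3 ≤ d → ∀ f : D, f ≠ 0 → f ∈ IsLocalRing.maximalIdeal D → ∀ T : Set (PrimeSpectrum (D ⧸ Ideal.span {f})), (∃ C ∈ T, C.asIdeal ∈ minimalPrimes (D ⧸ Ideal.span {f})) → (∃ C ∉ T,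 C.asIdeal ∈ minimalPrimes (D ⧸ Ideal.span {f})) → ∃ C₁ ∈ T, ∃ C₂ ∉ T, C₁.asIdeal ∈ minimalPrimes (D ⧸ Ideal.span {f}) ∧ C₂.asIdeal ∈ minimalPrimes (D ⧸ Ideal.span {f}) ∧ ((d - 2 : ℕ) : WithBot ℕ∞) ≤ ringKrullDim ((D ⧸ Ideal.span {f}) ⧸ (C₁.asIdeal ⊔ C₂.asIdeal))) :
    Literature.RingTheory.LocalCohomology.GrothendieckConnectedness := by
  classical
  -- strong induction on `k`
  suffices main : ∀ k : ℕ, 1 ≤ k → ∀ (A : Type) [CommRing A] [IsNoetherianRing A] [IsLocalRing A]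
      [IsAdicComplete (IsLocalRing.maximalIdeal A) A],
      (∀ P : Ideal A, P ∈ minimalPrimes A → ((k + 2 : ℕ) : WithBot ℕ∞) ≤ ringKrullDim (A ⧸ P)) →
      (∀ S : Set (PrimeSpectrum A), (∃ C ∈ S, C.asIdeal ∈ minimalPrimes A) →
        (∃ C ∉ S, C.asIdeal ∈ minimalPrimes A) →
          ∃ C₁ ∈ S, ∃ C₂ ∉ S, C₁.asIdeal ∈ minimalPrimes A ∧ C₂.asIdeal ∈ minimalPrimes A ∧
            ((k + 1 : ℕ) : WithBot ℕ∞) ≤ ringKrullDim (A ⧸ (C₁.asIdeal ⊔ C₂.asIdeal))) →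
      ∀ fs : List A, (∀ f ∈ fs, f ∈ IsLocalRing.maximalIdeal A) → fs.length ≤ k →
        (∀ Q : Ideal (A ⧸ Ideal.ofList fs), Q ∈ minimalPrimes (A ⧸ Ideal.ofList fs) →
          ((k - fs.length + 2 : ℕ) : WithBot ℕ∞) ≤ ringKrullDim ((A ⧸ Ideal.ofList fs) ⧸ Q)) ∧
        (∀ S : Set (PrimeSpectrum (A ⧸ Ideal.ofList fs)),
          (∃ C ∈ S, C.asIdeal ∈ minimalPrimes (A ⧸ Ideal.ofList fs)) →
          (∃ C ∉ S, C.asIdeal ∈ minimalPrimes (A ⧸ Ideal.ofList fs)) →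
            ∃ C₁ ∈ S, ∃ C₂ ∉ S, C₁.asIdeal ∈ minimalPrimes (A ⧸ Ideal.ofList fs) ∧
              C₂.asIdeal ∈ minimalPrimes (A ⧸ Ideal.ofList fs) ∧
              ((k - fs.length + 1 : ℕ) : WithBot ℕ∞) ≤
                ringKrullDim ((A ⧸ Ideal.ofList fs) ⧸ (C₁.asIdeal ⊔ C₂.asIdeal))) by
    intro A _ _ _ _ k hk ha hb fs hfs hlen
    exact main k hk A ha hb fs hfs hlen
  intro k
  induction k using Nat.strong_induction_on with
  | _ k IHk =>
  intro hk A _ _ _ _ ha hb fs hfs hlen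
  refine stub_raynaudConnectedness_auxComponents stub_raynaudConnectedness_auxDomainComponentDim A k fs
    hk hfs hlen ha hb ?_
  -- (dom): `T_dom(k)` for each irreducible component `D = A ⧸ P`
  intro P hP
  haveI hPp : P.IsPrime := hP.1.1
  haveI : Nontrivial (A ⧸ P) := Ideal.Quotient.nontrivial_iff.mpr hPp.ne_top
  haveI : IsLocalRing (A ⧸ P) := IsLocalRing.of_surjective' (Ideal.Quotient.mk P) Ideal.Quotient.mk_surjective
  haveI : IsAdicComplete (maximalIdeal (A ⧸ P)) (A ⧸ P) :=
    Literature.AlgebraicGeometry.Resolution.isAdicComplete_quotient P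
  -- `d = dim A/P ≥ k + 2`
  obtain ⟨d, hd⟩ := Literature.AlgebraicGeometry.Resolution.exists_nat_cast_eq_ringKrullDim (R := A ⧸ P)
  have hkd : k + 2 ≤ d := by
    have := ha P hP
    rw [hd] at this
    exact_mod_cast this
  -- Cohen: a complete regular local ring `S'` with `A/P` finite over it, `S' ↪ A/P`
  obtain ⟨S', _, hreg, _, hSc, hfin, hinjS⟩ := exists_regular_complete_finite_injective (A ⧸ P)
  haveI := hreg
  haveI := hfin
  haveI : IsAdicComplete (maximalIdeal S') S' := hSc
  haveI : IsDomain S' := Literature.AlgebraicGeometry.Resolution.isDomain_of_isRegularLocalRing S'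
  -- the reflexive hull `D'` of `A/P` over `S'` (H1a) and its ring-theoretic properties (H0)
  obtain ⟨D', a, b, Φ, Ψ, hΦ, hex⟩ := stub_raynaudConnectedness_auxHull S' (A ⧸ P) hinjS
  obtain ⟨hfinD', hnoeth, hint, hinjD, hinjSD', hdimD', hdimDS, hloc, hcompl, hmS, hradS⟩ :=
    stub_raynaudConnectedness_auxHullCompleteLocal S' (A ⧸ P) hinjS D' a Φ hΦ
  haveI := hnoeth
  haveI := hint
  haveI := hloc
  haveI := hcompl
  haveI := hfinD'
  have hdS : (d : WithBot ℕ∞) = ringKrullDim S' := by rw [← hdimDS, hd]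
  have hdD' : (d : WithBot ℕ∞) = ringKrullDim D' := by rw [hdimD', hd]
  -- (M1) for `D'`: hypersurfaces of the hull are connected in dimension `d - 2`
  have hM1D := fun (f : D') (hf0 : f ≠ 0) (hfm : f ∈ maximalIdeal D') =>
    hM1 S' D' hinjSD' hmS hradS a b Φ Ψ hΦ hex d hdS (by omega) f hf0 hfm
  -- `T''(k)` for `D'` with the images `fs'` of `fs`
  set π : A →+* A ⧸ P := Ideal.Quotient.mk P with hπ
  set fsP : List (A ⧸ P) := fs.map π with hfsP
  set fs' : List D' := fsP.map (algebraMap (A ⧸ P) D') with hfs'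
  have hfsPm : ∀ f ∈ fsP, f ∈ maximalIdeal (A ⧸ P) := by
    intro f hf
    obtain ⟨f₀, hf₀, rfl⟩ := List.mem_map.mp hf
    rw [← IsLocalRing.map_maximalIdeal_of_surjective π Ideal.Quotient.mk_surjective]
    exact Ideal.mem_map_of_mem _ (hfs f₀ hf₀)
  have hfs'm : ∀ f ∈ fs', f ∈ maximalIdeal D' := by
    intro f hf
    obtain ⟨f₀, hf₀, rfl⟩ := List.mem_map.mp hf
    exact map_maximalIdeal_le_of_isIntegral (A := A ⧸ P) (B := D') (Ideal.mem_map_of_mem _ (hfsPm f₀ hf₀))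
  have hlen' : fs'.length ≤ k := by rw [hfs', hfsP, List.length_map, List.length_map]; exact hlen
  have hT := gc_hull hk (fun k' hk' hk'1 => IHk k' hk' hk'1) hdD' hkd hM1D fs' hfs'm hlen'
  -- (G2): descend to `A/P` along the integral extension `A/P ⊆ D'`
  have hI : (Ideal.ofList fsP).map (algebraMap (A ⧸ P) D') = Ideal.ofList fs' := by
    rw [hfs', Ideal.map_ofList]
  have hT' := crossing_of_ringEquiv (R := D' ⧸ (Ideal.ofList fsP).map (algebraMap (A ⧸ P) D'))
    (Ideal.quotEquivOfEq hI) _ hT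
  have hbound : ((k - fs.length + 1 : ℕ) : WithBot ℕ∞) = ((k - fs'.length + 1 : ℕ) : WithBot ℕ∞) := by
    rw [hfs', hfsP, List.length_map, List.length_map]
  rw [hbound]
  exact crossing_of_isIntegral hinjD (Ideal.ofList fsP) _ hT'

/-- **Grothendieck's connectedness theorem, SGA 2 Exp. XIII Théorème 2.1 — PROVED.**  This discharges the
named literature fact `Literature.RingTheory.LocalCohomology.GrothendieckConnectedness` (stated there as
printed, in crossing form); hypothesis (M1) of `grothendieckConnectedness_of_hypersurfaceHull` is the landed
`stub_raynaudConnectedness_auxHypersurfaceHull`.  Trust base: none (axioms `propext`, `Classical.choice`,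
`Quot.sound`).  [cite: Grothendieck1968SGA2, Exp. XIII Thm. 2.1] -/
theorem GrothendieckConnectedness_holds : Literature.RingTheory.LocalCohomology.GrothendieckConnectedness :=
  grothendieckConnectedness_of_hypersurfaceHull stub_raynaudConnectedness_auxHypersurfaceHull

end Main

end Summit.Langlands.Langlands.Theorems

/-! ## 5. The registered sub-goal -/

namespace Summit.Langlands.Langlands.Cruxes.ReducibleOrdinaryProModular.FineSelmerCodimensionTwo

/-- **Registered sub-goal `stub_raynaudConnectedness_auxGrothendieck` of stub (R) `stub_raynaudConnectedness`**:
Grothendieck's connectedness theorem SGA 2 XIII 2.1 (the named fact, discharged by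
`Theorems.GrothendieckConnectedness_holds`). [cite: Grothendieck1968SGA2, Exp. XIII Thm. 2.1] -/
theorem stub_raynaudConnectedness_auxGrothendieck : Literature.RingTheory.LocalCohomology.GrothendieckConnectedness :=
  Summit.Langlands.Langlands.Theorems.GrothendieckConnectedness_holds

end Summit.Langlands.Langlands.Cruxes.ReducibleOrdinaryProModular.FineSelmerCodimensionTwo

end
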